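import Summits.Ventures.HSemireg.WeilFrameTwoSlope
import Summits.Ventures.HSemireg.Mod4OneSlopeSpectrum

/-!
# Venture HSemireg — TABLE R's `ρ(f) = 1` ROW ON THE REAL CARRIER, every `n`: the ONE-SLOPE classes `v = A e^{λh} + w`
# (`R_m = 3C(2n,m) − 2C(n,m)`, `R_n = 3C(2n,n) − 2`, Mukai density `(2(−1)ⁿt/(2n)!)·ĥ^{2n}`)

HONEST FRAMING. Part of the Lean index of the computation cell `pub-hsemireg` (seat w3-mod4-1 gen 9, W3 SPECIAL FIBRES;
MOD4-OFFSPLIT TABLE R row «ρ(f) = 1: (1,8,16,8,1) / (1,12,39,58,39,12,1) / (1,16,72,160,208,160,72,16,1)», THEOREM A's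
semihomogeneous shapes). The tree's real carriers and the Literature's Weil-type layer ONLY: no semiregularity map, no Ext group, no
`∫`; nothing here says that HC / HC_CM / HC_AV holds; nothing here is a claim about any explicit variety; no Literature fact is
declared; NO definition is introduced. Independent of the unbuilt `Mod4Carrier*` modules (imports: FILE 22, FILE 23).

WHAT IS PROVED, for `A : AbelianVariety ℂ` of dimension `2n` (`n ≥ 1`), `φ ≫ φ = -(d • 𝟙 A)`, `d ≥ 1`, `P, Q` the `±i√d`-eigenspaces,
`dim (P ⊓ H^{1,0}) = n`, `h` `K`-symmetric of type `(1,1)` with `ĥ^{2n} ≠ 0`, non-zero `c± ∈ E±`, the class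
`x = Σ_{m ≤ 2n} (q_m/m!) ĥ^m + ĉ₊ + ĉ₋` with `q_m = Aλ^m`, `A ≠ 0` («one slope», `f = A e^{λh}`), pin `(2n)!·(ĉ₊ĉ₋) = t·ĥ^{2n}`:
* **`finrank_S_oneSlope_deg`** — `dim S_m(x) + 2C(n,m) = 3C(2n,m)` for `1 ≤ m ≤ n - 1` (`r_m = 1`, `Mod4.hankel1_rank_oneSlope`);
* **`finrank_S_oneSlope_middle`** — `dim S_n(x) + 2 = 3C(2n,n)` (`M_f(q) = 0`, `t ≠ 0`);
* **`proj_mukaiDual_mul_top_oneSlope`** — the degree-`4n` part of `x^∨ · x` is `(2(-1)ⁿ t/(2n)!) · ĥ^{2n}` (`P_f(q) = 0`: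
  «`(f,f)_χ = 0`», the semihomogeneous h-part pairs to zero with itself).
At `n = 3`: `R = (1, 12, 39, 58, 39, 12, 1)` (upper half by FILE 15 once built). Everything PROVED, 0 sorry.
References: [BuchweitzFlenner2008HH] Prop. 6.4.4; [vanGeemen1994HodgeAV] 4.9, Lemma 5.2; [BourbakiAlgebre1a3] Ch. III §8, §11 no. 9.
-/

noncomputable section

open CliffordAlgebra (contractLeft)
open ExteriorAlgebra (ι)
open Module CategoryTheory
open Literature.AlgebraicGeometry.Motives Literature.AlgebraicGeometry.HodgeTheory
open Literature.AlgebraicTopology.SingularHomology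

namespace Summit.Ventures.HSemireg.WeilFrame

open Summit.Ventures.HSemireg.WedgeBridge Summit.Ventures.HSemireg.WeilCarrier Summit.Ventures.HSemireg.Mod4Carrier
open Summit.Ventures.HSemireg.Wedge.Hankel

section RealCarrier

variable {A : AbelianVariety ℂ}

/-- **`ρ(f) = 1`, lower side degrees on the real carrier** (`1 ≤ m ≤ n - 1`): for `q_m = Aλ^m`, `A ≠ 0`:
`dim S_m(x) + 2C(n,m) = 3C(2n,m)` (`r_m = 1`). [cite: BuchweitzFlenner2008HH, Prop. 6.4.4] -/
theorem finrank_S_oneSlope_deg (hA : IsSmoothProjective A.dim A.X) {n d : ℕ} (hdim : A.dim = n + n) (hd : 0 < d)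
    {φ : A ⟶ A} (hφ : φ ≫ φ = -(d • 𝟙 A)) {P Q : Submodule ℂ (complexBetti A.X 1)}
    (hP : P = Module.End.eigenspace (complexBetti.map φ.hom.hom.hom 1).hom (Complex.I * (Real.sqrt d : ℂ)))
    (hQ : Q = Module.End.eigenspace (complexBetti.map φ.hom.hom.hom 1).hom (-(Complex.I * (Real.sqrt d : ℂ))))
    (hp : finrank ℂ ↥(P ⊓ hodgeOneZero hA) = n) {h : complexBetti A.X 2}
    (hh : complexBetti.map φ.hom.hom.hom 2 h = (d : ℂ) • h) (h11 : IsOfHodgeType A.dim A.X 2 1 1 h)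
    (hvol : ((⋀[ℂ]^2 (complexBetti A.X 1)).subtype ((abelianVarietyCohomologyExteriorH1_holds.equiv A 2).symm h)) ^ (n + n) ≠ 0)
    {cP cQ : complexBetti A.X (2 * n)} (hcP : cP ∈ weilClassesPlus A φ n d) (hcP0 : cP ≠ 0)
    (hcQ : cQ ∈ weilClassesMinus A φ n d) (hcQ0 : cQ ≠ 0)
    {Aₛ : ℂ} (la : ℂ) (hAs : Aₛ ≠ 0) {m : ℕ} (hm1 : 1 ≤ m) (hmn : m + 1 ≤ n) :
    finrank ℂ ↥(S ℂ (hodgeZeroOne hA) m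
        ((∑ m ∈ Finset.range (n + n + 1), ((Aₛ * la ^ m) * ((m.factorial : ℕ) : ℂ)⁻¹) •
            ((⋀[ℂ]^2 (complexBetti A.X 1)).subtype ((abelianVarietyCohomologyExteriorH1_holds.equiv A 2).symm h)) ^ m) +
          (⋀[ℂ]^(2 * n) (complexBetti A.X 1)).subtype ((abelianVarietyCohomologyExteriorH1_holds.equiv A (2 * n)).symm cP) +
          (⋀[ℂ]^(2 * n) (complexBetti A.X 1)).subtype ((abelianVarietyCohomologyExteriorH1_holds.equiv A (2 * n)).symm cQ))) + 2 * n.choose m = 3 * (n + n).choose m := by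
  haveI : Module.Finite ℂ (complexBetti A.X 1) := abelianVarietyCohomologyExteriorH1_holds.finite_one A
  have h : finrank ℂ ↥(S ℂ (hodgeZeroOne hA) m
        ((∑ m ∈ Finset.range (n + n + 1), ((Aₛ * la ^ m) * ((m.factorial : ℕ) : ℂ)⁻¹) •
            ((⋀[ℂ]^2 (complexBetti A.X 1)).subtype ((abelianVarietyCohomologyExteriorH1_holds.equiv A 2).symm h)) ^ m) +
          (⋀[ℂ]^(2 * n) (complexBetti A.X 1)).subtype ((abelianVarietyCohomologyExteriorH1_holds.equiv A (2 * n)).symm cP) +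
          (⋀[ℂ]^(2 * n) (complexBetti A.X 1)).subtype ((abelianVarietyCohomologyExteriorH1_holds.equiv A (2 * n)).symm cQ))) +
        (n.choose m + n.choose m) * (hankel1 ℂ (n + n) m (fun m => Aₛ * la ^ m)).rank =
      (n + n).choose m + (n + n).choose m + (n + n).choose m * (hankel1 ℂ (n + n) m (fun m => Aₛ * la ^ m)).rank :=
    finrank_S_weilType_deg hA hdim hd hφ hP hQ hp hh h11 hvol hcP hcP0 hcQ hcQ0 (fun m => Aₛ * la ^ m) hm1 hmn
  rw [Mod4.hankel1_rank_oneSlope (by omega) la hAs] at h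
  omega

/-- **`ρ(f) = 1`, middle degree on the real carrier:** `dim S_n(x) + 2 = 3C(2n,n)` (`r_n = 1`, `M_f(q) = 0`, the pin `t ≠ 0`).
[cite: BuchweitzFlenner2008HH, Prop. 6.4.4] -/
theorem finrank_S_oneSlope_middle (hA : IsSmoothProjective A.dim A.X) {n d : ℕ} (hdim : A.dim = n + n) (hd : 0 < d)
    {φ : A ⟶ A} (hφ : φ ≫ φ = -(d • 𝟙 A)) {P Q : Submodule ℂ (complexBetti A.X 1)}
    (hP : P = Module.End.eigenspace (complexBetti.map φ.hom.hom.hom 1).hom (Complex.I * (Real.sqrt d : ℂ)))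
    (hQ : Q = Module.End.eigenspace (complexBetti.map φ.hom.hom.hom 1).hom (-(Complex.I * (Real.sqrt d : ℂ))))
    (hp : finrank ℂ ↥(P ⊓ hodgeOneZero hA) = n) {h : complexBetti A.X 2}
    (hh : complexBetti.map φ.hom.hom.hom 2 h = (d : ℂ) • h) (h11 : IsOfHodgeType A.dim A.X 2 1 1 h)
    (hvol : ((⋀[ℂ]^2 (complexBetti A.X 1)).subtype ((abelianVarietyCohomologyExteriorH1_holds.equiv A 2).symm h)) ^ (n + n) ≠ 0)
    {cP cQ : complexBetti A.X (2 * n)} (hcP : cP ∈ weilClassesPlus A φ n d) (hcP0 : cP ≠ 0)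
    (hcQ : cQ ∈ weilClassesMinus A φ n d) (hcQ0 : cQ ≠ 0)
    {Aₛ : ℂ} (la : ℂ) (hAs : Aₛ ≠ 0) (hn : 1 ≤ n) {t : ℂ}
    (ht : (((n + n).factorial : ℕ) : ℂ) • ((⋀[ℂ]^(2 * n) (complexBetti A.X 1)).subtype ((abelianVarietyCohomologyExteriorH1_holds.equiv A (2 * n)).symm cP) *
        (⋀[ℂ]^(2 * n) (complexBetti A.X 1)).subtype ((abelianVarietyCohomologyExteriorH1_holds.equiv A (2 * n)).symm cQ)) =
      t • ((⋀[ℂ]^2 (complexBetti A.X 1)).subtype ((abelianVarietyCohomologyExteriorH1_holds.equiv A 2).symm h)) ^ (n + n)) :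
    finrank ℂ ↥(S ℂ (hodgeZeroOne hA) n
        ((∑ m ∈ Finset.range (n + n + 1), ((Aₛ * la ^ m) * ((m.factorial : ℕ) : ℂ)⁻¹) •
            ((⋀[ℂ]^2 (complexBetti A.X 1)).subtype ((abelianVarietyCohomologyExteriorH1_holds.equiv A 2).symm h)) ^ m) +
          (⋀[ℂ]^(2 * n) (complexBetti A.X 1)).subtype ((abelianVarietyCohomologyExteriorH1_holds.equiv A (2 * n)).symm cP) +
          (⋀[ℂ]^(2 * n) (complexBetti A.X 1)).subtype ((abelianVarietyCohomologyExteriorH1_holds.equiv A (2 * n)).symm cQ))) + 2 = 3 * (n + n).choose n := by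
  haveI : Module.Finite ℂ (complexBetti A.X 1) := abelianVarietyCohomologyExteriorH1_holds.finite_one A
  have ht0 := pin_ne_zero_weilType hA hdim hd hφ hP hQ hp hh h11 hvol hcP hcP0 hcQ hcQ0 ht
  have h : finrank ℂ ↥(S ℂ (hodgeZeroOne hA) n
        ((∑ m ∈ Finset.range (n + n + 1), ((Aₛ * la ^ m) * ((m.factorial : ℕ) : ℂ)⁻¹) •
            ((⋀[ℂ]^2 (complexBetti A.X 1)).subtype ((abelianVarietyCohomologyExteriorH1_holds.equiv A 2).symm h)) ^ m) +
          (⋀[ℂ]^(2 * n) (complexBetti A.X 1)).subtype ((abelianVarietyCohomologyExteriorH1_holds.equiv A (2 * n)).symm cP) +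
          (⋀[ℂ]^(2 * n) (complexBetti A.X 1)).subtype ((abelianVarietyCohomologyExteriorH1_holds.equiv A (2 * n)).symm cQ))) +
        2 * (hankel1 ℂ (n + n) n (fun m => Aₛ * la ^ m)).rank +
        finrank ℂ ↥(LinearMap.ker (Matrix.toLin' (Mod4.middleM n (fun m => Aₛ * la ^ m)) - t • LinearMap.id)) =
      ((hankel1 ℂ (n + n) n (fun m => Aₛ * la ^ m)).rank + 2) * (n + n).choose n :=
    finrank_S_weilType_middle hA hdim hd hφ hP hQ hp hh h11 hvol hcP hcP0 hcQ hcQ0 hn (fun m => Aₛ * la ^ m) ht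
  rw [Mod4.hankel1_rank_oneSlope (by omega) la hAs, Mod4.finrank_ker_middleM_oneSlope hn Aₛ la ht0] at h
  omega

/-- **Mukai density of a one-slope class on the real carrier:** the degree-`4n` part of `x^∨ · x` is `(2(-1)ⁿ t/(2n)!) · ĥ^{2n}`
(`P_f(q) = 0`: «`(f,f)_χ = 0`»). [cite: MumfordAV1970, §16] [cite: BuchweitzFlenner2008HH, Prop. 6.4.4] -/
theorem proj_mukaiDual_mul_top_oneSlope (hA : IsSmoothProjective A.dim A.X) {n d : ℕ} (hdim : A.dim = n + n) (hd : 0 < d)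
    {φ : A ⟶ A} (hφ : φ ≫ φ = -(d • 𝟙 A)) {P Q : Submodule ℂ (complexBetti A.X 1)}
    (hP : P = Module.End.eigenspace (complexBetti.map φ.hom.hom.hom 1).hom (Complex.I * (Real.sqrt d : ℂ)))
    (hQ : Q = Module.End.eigenspace (complexBetti.map φ.hom.hom.hom 1).hom (-(Complex.I * (Real.sqrt d : ℂ))))
    (hp : finrank ℂ ↥(P ⊓ hodgeOneZero hA) = n) {h : complexBetti A.X 2}
    (hh : complexBetti.map φ.hom.hom.hom 2 h = (d : ℂ) • h) (h11 : IsOfHodgeType A.dim A.X 2 1 1 h)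
    (hvol : ((⋀[ℂ]^2 (complexBetti A.X 1)).subtype ((abelianVarietyCohomologyExteriorH1_holds.equiv A 2).symm h)) ^ (n + n) ≠ 0)
    {cP cQ : complexBetti A.X (2 * n)} (hcP : cP ∈ weilClassesPlus A φ n d) (hcP0 : cP ≠ 0)
    (hcQ : cQ ∈ weilClassesMinus A φ n d) (hcQ0 : cQ ≠ 0)
    (Aₛ la : ℂ) (hn : 1 ≤ n) {t : ℂ}
    (ht : (((n + n).factorial : ℕ) : ℂ) • ((⋀[ℂ]^(2 * n) (complexBetti A.X 1)).subtype ((abelianVarietyCohomologyExteriorH1_holds.equiv A (2 * n)).symm cP) *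
        (⋀[ℂ]^(2 * n) (complexBetti A.X 1)).subtype ((abelianVarietyCohomologyExteriorH1_holds.equiv A (2 * n)).symm cQ)) =
      t • ((⋀[ℂ]^2 (complexBetti A.X 1)).subtype ((abelianVarietyCohomologyExteriorH1_holds.equiv A 2).symm h)) ^ (n + n)) :
    GradedAlgebra.proj (fun i : ℕ => ⋀[ℂ]^i (complexBetti A.X 1)) ((n + n) + (n + n))
        (((∑ m ∈ Finset.range (n + n + 1), (((-1 : ℂ) ^ m * (Aₛ * la ^ m)) * ((m.factorial : ℕ) : ℂ)⁻¹) •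
              ((⋀[ℂ]^2 (complexBetti A.X 1)).subtype ((abelianVarietyCohomologyExteriorH1_holds.equiv A 2).symm h)) ^ m) +
            (-1 : ℂ) ^ n •
              ((⋀[ℂ]^(2 * n) (complexBetti A.X 1)).subtype ((abelianVarietyCohomologyExteriorH1_holds.equiv A (2 * n)).symm cP) +
                (⋀[ℂ]^(2 * n) (complexBetti A.X 1)).subtype ((abelianVarietyCohomologyExteriorH1_holds.equiv A (2 * n)).symm cQ))) *
          ((∑ m ∈ Finset.range (n + n + 1), ((Aₛ * la ^ m) * ((m.factorial : ℕ) : ℂ)⁻¹) •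
            ((⋀[ℂ]^2 (complexBetti A.X 1)).subtype ((abelianVarietyCohomologyExteriorH1_holds.equiv A 2).symm h)) ^ m) +
            (⋀[ℂ]^(2 * n) (complexBetti A.X 1)).subtype ((abelianVarietyCohomologyExteriorH1_holds.equiv A (2 * n)).symm cP) +
            (⋀[ℂ]^(2 * n) (complexBetti A.X 1)).subtype ((abelianVarietyCohomologyExteriorH1_holds.equiv A (2 * n)).symm cQ))) =
      ((2 * ((-1 : ℂ) ^ n * t)) * ((((n + n).factorial : ℕ) : ℂ)⁻¹)) •
        ((⋀[ℂ]^2 (complexBetti A.X 1)).subtype ((abelianVarietyCohomologyExteriorH1_holds.equiv A 2).symm h)) ^ (n + n) := by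
  rw [proj_mukaiDual_mul_top_weilType hA hdim hd hφ hP hQ hp hh h11 hvol hcP hcP0 hcQ hcQ0 hn (fun m => Aₛ * la ^ m) ht,
    Mod4.mukaiP_oneSlope hn, zero_add]

end RealCarrier

end Summit.Ventures.HSemireg.WeilFrame

end
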